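import Literature.Geometry.Lorentzian.LeviCivitaProofs
import Literature.Geometry.Lorentzian.CurvatureSymmetries
import HarnessLib

/-!
# Conformally related metrics: Koszul functional, Levi-Civita connection and Hessian

Support file for the discharge of
`Literature.Geometry.Riemannian.ggsu_boundary_sphere_of_nonTrapping_of_nonpos`
(`SimpleAHBoundarySphere.lean`). For two `C^n` pseudo-Riemannian metrics `g`, `ĝ` on `TM` with
`ĝ = r² g` for a function `r : M → ℝ` (differentiable, non-vanishing where needed) we prove the
classical transformation laws (O'Neill 1983, Ch. 3, Thm. 3.11 via the Koszul formula; Besse,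
*Einstein manifolds*, Thm. 1.159 (a)):

* `koszulFunctional_conformal` — `K_ĝ(X,Y,Z) = r² K_g(X,Y,Z) + 2r (dr(X) g(Y,Z) + dr(Y) g(Z,X) - dr(Z) g(X,Y))`;
* `leviCivita_conformal_apply` — `∇̂_{X₀} Y = ∇_{X₀} Y + (dr(X₀)/r) Y + (dr(Y)/r) X₀ - (g(X₀,Y)/r) grad_g r`;
* `hessian_conformal_apply_self` —
  `Hess^ĝ f (u,u) = Hess^g f (u,u) - (2 dr(u)/r) df(u) + (g(u,u)/r) df(grad_g r)`.

Everything is proved; no definitions, no named facts.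

## References

* B. O'Neill, *Semi-Riemannian geometry with applications to relativity*, Academic Press 1983,
  Ch. 3, Thm. 3.11 (Koszul formula), Def. 3.48–Lemma 3.49 (Hessian). [ONeill1983]
* A. L. Besse, *Einstein manifolds*, Springer 1987, Thm. 1.159 (conformal changes of metric).
-/

noncomputable section

open Bundle Set NormedSpace FiberBundle VectorField
open scoped Manifold ContDiff Topology

namespace Literature.Geometry.Riemannian.GGSU

open Literature.Geometry.Lorentzian
open Literature.Geometry.Lorentzian.PseudoRiemannianMetric

variable {E : Type*} [NormedAddCommGroup E] [NormedSpace ℝ E] {H : Type*} [TopologicalSpace H]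
  {I : ModelWithCorners ℝ E H} {M : Type*} [TopologicalSpace M] [ChartedSpace H M]
  [IsManifold I ∞ M] {n : ℕ∞ω} [Fact (1 ≤ n)] [CompleteSpace E]
  {g ĝ : PseudoRiemannianMetric I n E (TangentSpace I : M → Type _)} {r : M → ℝ} {x : M}

omit [CompleteSpace E] in
/-- The Koszul functional of `ĝ = r² g`: for fields differentiable at `x` and `r` differentiable at
`x`, `K_ĝ(X,Y,Z)(x) = r² K_g(X,Y,Z)(x) + 2 r (dr(X) g(Y,Z) + dr(Y) g(Z,X) - dr(Z) g(X,Y))`.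
[cite: ONeill1983, Ch. 3, Thm. 3.11 (Koszul formula)] -/
theorem koszulFunctional_conformal (hval : ∀ y, ĝ.val y = (r y) ^ 2 • g.val y)
    (hr : MDiffAt r x) {X Y Z : Π x : M, TangentSpace I x}
    (hX : MDiffAt (T% X) x) (hY : MDiffAt (T% Y) x) (hZ : MDiffAt (T% Z) x) :
    ĝ.koszulFunctional X Y Z x =
      (r x) ^ 2 * g.koszulFunctional X Y Z x +
        2 * r x * (mvfderiv I r x (X x) * g.val x (Y x) (Z x) +
          mvfderiv I r x (Y x) * g.val x (Z x) (X x) - mvfderiv I r x (Z x) * g.val x (X x) (Y x)) := by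
  have hr2 : MDiffAt (r * r) x := hr.mul hr
  have e : ∀ A B : Π x : M, TangentSpace I x,
      (fun y ↦ ĝ.val y (A y) (B y)) = (r * r) * fun y ↦ g.val y (A y) (B y) := by
    intro A B; funext y
    simp only [hval y, Pi.mul_apply, FunLike.coe_smul, Pi.smul_apply, smul_eq_mul]
    ring
  have d : ∀ {A B : Π x : M, TangentSpace I x}, MDiffAt (T% A) x → MDiffAt (T% B) x →
      ∀ v, mvfderiv I (fun y ↦ ĝ.val y (A y) (B y)) x v =
        (r x) ^ 2 * mvfderiv I (fun y ↦ g.val y (A y) (B y)) x v +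
          2 * r x * mvfderiv I r x v * g.val x (A x) (B x) := by
    intro A B hA hB v
    rw [e A B, mvfderiv_mul hr2 (g.mdifferentiableAt_val_apply hA hB), mvfderiv_mul hr hr]
    simp only [add_apply, FunLike.coe_smul, Pi.smul_apply, smul_eq_mul,
      Pi.mul_apply]
    ring
  simp only [koszulFunctional]
  rw [d hY hZ, d hZ hX, d hX hY]
  simp only [hval x, FunLike.coe_smul, Pi.smul_apply, smul_eq_mul]
  ring

variable [FiniteDimensional ℝ E] [g.HasLeviCivita] [ĝ.HasLeviCivita]

/-- **Levi-Civita connection of a conformally related metric.** If `ĝ = r² g` with `r`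
differentiable and `r x ≠ 0`, then for a field `Y` differentiable at `x` and `X₀ ∈ T_x M`,
`∇̂_{X₀} Y = ∇_{X₀} Y + (dr(X₀)/r) Y_x + (dr(Y_x)/r) X₀ - (g(X₀, Y_x)/r) ♯_g dr`.
[cite: ONeill1983, Ch. 3, Thm. 3.11 (Koszul formula)] -/
theorem leviCivita_conformal_apply (hval : ∀ y, ĝ.val y = (r y) ^ 2 • g.val y)
    (hr : MDiffAt r x) (hrx : r x ≠ 0) {Y : Π x : M, TangentSpace I x} (hY : MDiffAt (T% Y) x)
    (X₀ : TangentSpace I x) :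
    ĝ.leviCivita Y x X₀ = g.leviCivita Y x X₀ + (mvfderiv I r x X₀ / r x) • Y x +
      (mvfderiv I r x (Y x) / r x) • X₀ -
        (g.val x X₀ (Y x) / r x) • g.sharp x (mvfderiv I r x).toLinearMap := by
  -- test against an arbitrary `Z₀` through the Koszul formula on extended vectors
  have key : ∀ Z₀ : TangentSpace I x, g.val x (ĝ.leviCivita Y x X₀) Z₀ =
      g.val x (g.leviCivita Y x X₀ + (mvfderiv I r x X₀ / r x) • Y x +
        (mvfderiv I r x (Y x) / r x) • X₀ -
          (g.val x X₀ (Y x) / r x) • g.sharp x (mvfderiv I r x).toLinearMap) Z₀ := by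
    intro Z₀
    have hX : MDiffAt (T% (extend E X₀)) x := mdifferentiableAt_extend ..
    have hZ : MDiffAt (T% (extend E Z₀)) x := mdifferentiableAt_extend ..
    have h1 := ĝ.two_mul_val_leviCivita_apply_holds hX hY hZ
    have h2 := g.two_mul_val_leviCivita_apply_holds hX hY hZ
    rw [koszulFunctional_conformal hval hr hX hY hZ, ← h2] at h1
    simp only [extend_apply_self, hval x, FunLike.coe_smul, Pi.smul_apply, smul_eq_mul] at h1
    simp only [map_add, map_sub, map_smul, add_apply,
      sub_apply, FunLike.coe_smul, Pi.smul_apply, smul_eq_mul,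
      val_sharp_apply, ContinuousLinearMap.coe_coe]
    rw [g.symm x Z₀ X₀] at h1
    field_simp
    refine mul_left_cancel₀ (mul_ne_zero two_ne_zero hrx) ?_
    linear_combination h1
  have h0 := fun Z₀ ↦ sub_eq_zero.2 (key Z₀)
  have := g.nondegenerate x _ fun Z₀ ↦ by rw [map_sub, sub_apply]; exact h0 Z₀
  exact sub_eq_zero.1 this

/-- **Hessian of a conformally related metric** on the diagonal: if `ĝ = r² g` with `r`
differentiable and `r x ≠ 0`, then for `f` of class `C²` at `x` and `u ∈ T_x M`,
`Hess^ĝ f_x(u,u) = Hess^g f_x(u,u) - (2 dr(u)/r) df(u) + (g(u,u)/r) df(♯_g dr)`.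
[cite: ONeill1983, Ch. 3, Def. 3.48–Lemma 3.49 with Thm. 3.11] -/
theorem hessian_conformal_apply_self (hval : ∀ y, ĝ.val y = (r y) ^ 2 • g.val y)
    (hr : MDiffAt r x) (hrx : r x ≠ 0) {f : M → ℝ} (hf : CMDiffAt 2 f x) (u : TangentSpace I x) :
    ĝ.hessian f x u u = g.hessian f x u u - (2 * mvfderiv I r x u / r x) * mvfderiv I f x u +
      (g.val x u u / r x) * mvfderiv I f x (g.sharp x (mvfderiv I r x).toLinearMap) := by
  have hU : MDiffAt (T% (extend E u)) x := mdifferentiableAt_extend ..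
  have h1 := ĝ.hessian_apply_holds hf hU hU
  have h2 := g.hessian_apply_holds hf hU hU
  simp only [extend_apply_self] at h1 h2
  rw [h1, h2]
  simp only [hessianAux, extend_apply_self]
  rw [leviCivita_conformal_apply hval hr hrx hU u]
  simp only [extend_apply_self, map_add, map_sub, map_smul, smul_eq_mul]
  ring

end Literature.Geometry.Riemannian.GGSU
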